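import Literature.Analysis.FluidPDE.OnsagerBDSVPerturbation
import HarnessLib

/-!
# The BDSV perturbation: smoothness of the construction of §5

Sequel to `OnsagerBDSVPerturbation.lean` (Buckmaster–De Lellis–Székelyhidi–Vicol 2019, §5: the
perturbation `w_{q+1}` in curl form (5.28), the new stress (5.23) and the new pressure, as honest
definitions over Mikado data, cut-offs and backward flows). This file PROVES that every object of
the construction is jointly smooth on `[0,T] × T³` under the evident hypotheses — bundled as
`BDSV.SmoothData P S η D`: `T > 0`; `e` smooth on `[0,T]`; `v̄_q, p̄_q, R̊̄_q`, the cut-offs `η_i`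
and the displacements `D_i` jointly smooth; `ρ_q > 0` (Lemma 5.4 (5.15)) and `∑_j∫η_j² > 0`
(property (v) of §5.2) on `[0,T]` — which is the regularity half of §5.4 ("one may verify that
`(v_{q+1}, p_{q+1}, R̊_{q+1})` solves the Euler–Reynolds system": the triple has to be smooth):

* general lemmas: space integrals of jointly smooth fields are smooth in time (a private copy
  of `IsSmoothSpaceTimeOn.contDiffOn_integral` of `NavierStokesConcentrationTools.lean`, whose
  import would pull the Navier–Stokes closure and, with `VectorCalculus.lean`, shadow the bare
  torus operators `convect`, `divergence`, … inside `Literature.Analysis.FluidPDE`),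
  `Torus.proj_nsmul`, smoothness from components
  (`BDSV.isSmoothSpaceTimeOn_iff_components`), of `BDSV.curl` (`IsSmoothSpaceTimeOn.curl`), of
  matrix actions (`BDSV.isSmoothSpaceTimeOn_toEuclideanLin`) and of tensor divergences
  (`IsSmoothSpaceTimeOn.tensorDivergence`);
* the ingredients: `ρ_q` and `∑∫η_j²` are smooth in time (`BDSV.contDiffOn_rhoQ`,
  `BDSV.contDiffOn_etaMass`), `ρ_{q,i}`, `ρ_{q,i}^{1/2}`, the entries of `∇Φ_i` and of `R̃_{q,i}`
  are jointly smooth, and so is the composite `V(R̃_{q,i}, n_{q+1}Φ_i)` with a Mikado profile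
  (`BDSV.isSmoothSpaceTimeOn_mikado_comp`, through the lift `proj (n • (y + D)) = n • Φ`);
* under `SmoothData`: the potential `Z`, the perturbation `w_{q+1} = n⁻¹ curl Z`, the new velocity,
  the columns of `R̄_q`, the oscillation tensor `w ⊗ w - R̄_q`, the source `F` of (5.23), the new
  stress `ℛF` (`IsSmoothSpaceTimeOn.antidivergence`) and the new pressure are jointly smooth
  (`BDSV.SmoothData.potential`, `.perturbation`, `.newVelocity`, `.stressSum_column`,
  `.oscillationTensor`, `.stressSource`, `.newStress`, `.newPressure`).

The Euler–Reynolds identity itself (the discharge of `BDSV.newTriple_isEulerReynolds`) is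
`OnsagerBDSVPerturbationER.lean`.

## References

* T. Buckmaster, C. De Lellis, L. Székelyhidi Jr., V. Vicol, *Onsager's conjecture for admissible
  weak solutions*, Comm. Pure Appl. Math. 72 (2019) = arXiv:1701.08678, §5.2–5.4.
-/

open MeasureTheory Set
open scoped NNReal ENNReal ContDiff Matrix Matrix.Norms.Elementwise

noncomputable section

namespace Literature.Analysis.FluidPDE

namespace BDSV

open FunctionSpaces FunctionSpaces.Torus

/-- The flat three-torus `T³ = (ℝ/ℤ)³`, local notation. -/
local notation "𝕋³" => UnitAddTorus (Fin 3)

/-- Euclidean `ℝ³`, local notation. -/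
local notation "ℝ³" => EuclideanSpace ℝ (Fin 3)

/-- Real `3 × 3` matrices, local notation. -/
local notation "𝕄" => Matrix (Fin 3) (Fin 3) ℝ

/-! ## General lemmas: smooth dependence of space integrals on time; lifts -/

section General

variable {d : Type*} [Fintype d] {F : Type*} [NormedAddCommGroup F] [NormedSpace ℝ F]

/-- Space integrals of a jointly smooth field are smooth functions of time within a convex time
set with nonempty interior (differentiate under the integral sign,
`IsSmoothSpaceTimeOn.hasDerivWithinAt_integral`, and induct on the order). A private copy of
`IsSmoothSpaceTimeOn.contDiffOn_integral` (`NavierStokesConcentrationTools.lean`), not imported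
here to keep the Navier–Stokes closure (and the `ℝ³` operators of `VectorCalculus.lean`, which
shadow the bare torus operators inside this namespace) out of the BDSV files. [folklore] -/
private theorem contDiffOn_spaceIntegral
    {S : Set ℝ} (hS : Convex ℝ S) (hSi : (interior S).Nonempty) {u : ℝ → UnitAddTorus d → F}
    (hu : IsSmoothSpaceTimeOn S u) : ContDiffOn ℝ ∞ (fun t => ∫ x, u t x) S := by
  have hU : UniqueDiffOn ℝ S := uniqueDiffOn_convex hS hSi
  suffices h : ∀ (n : ℕ) (w : ℝ → UnitAddTorus d → F), IsSmoothSpaceTimeOn S w →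
      ContDiffOn ℝ n (fun t => ∫ x, w t x) S by
    rw [contDiffOn_infty]
    exact fun n => h n u hu
  intro n
  induction n with
  | zero =>
    intro w hw
    exact contDiffOn_zero.2 (hw.continuousOn_integral hS)
  | succ n ih =>
    intro w hw
    have hderiv : ∀ t ∈ S, HasDerivWithinAt (fun s => ∫ x, w s x)
        (∫ x, timeDerivWithin S w t x) S t := fun t ht => hw.hasDerivWithinAt_integral hS ht
    refine (contDiffOn_succ_iff_derivWithin hU).2 ⟨fun t ht => (hderiv t ht).differentiableWithinAt,
      fun h => (WithTop.natCast_ne_top n h).elim, ?_⟩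
    have heq : EqOn (derivWithin (fun s => ∫ x, w s x) S) (fun t => ∫ x, timeDerivWithin S w t x) S :=
      fun t ht => (hderiv t ht).derivWithin (hU t ht)
    exact (ih _ (hw.timeDerivWithin hU)).congr heq

omit [Fintype d] in
/-- `proj (n • y) = n • proj y` for natural `n`. [folklore] -/
theorem _root_.Literature.Analysis.FunctionSpaces.Torus.proj_nsmul (n : ℕ) (y : EuclideanSpace ℝ d) :
    proj (n • y) = n • proj y := by
  induction n with
  | zero => simp [proj_zero]
  | succ n ih => rw [succ_nsmul, succ_nsmul, proj_add, ih]

end General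

/-! ## Smoothness of vector fields on `T³` from components; curl; matrix actions -/

section Components

variable {S : Set ℝ}

/-- A time-dependent `ℝ³`-valued field on `T³` is jointly smooth iff its three components are. [folklore] -/
theorem isSmoothSpaceTimeOn_iff_components {u : ℝ → 𝕋³ → ℝ³} :
    IsSmoothSpaceTimeOn S u ↔ ∀ i, IsSmoothSpaceTimeOn S (fun t x => u t x i) :=
  contDiffOn_piLp 2

/-- The curl of a jointly smooth field is jointly smooth (on time sets of unique
differentiability). [folklore] -/
theorem _root_.Literature.Analysis.FunctionSpaces.Torus.IsSmoothSpaceTimeOn.curl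
    {u : ℝ → 𝕋³ → ℝ³} (hu : IsSmoothSpaceTimeOn S u) (hS : UniqueDiffOn ℝ S) :
    IsSmoothSpaceTimeOn S (fun t => curl (u t)) := by
  have hD : ∀ j i : Fin 3, IsSmoothSpaceTimeOn S (fun t x => partialDeriv j (u t) x i) :=
    fun j i => (hu.partialDeriv hS j).apply i
  rw [isSmoothSpaceTimeOn_iff_components]
  intro i
  fin_cases i
  · exact (hD 1 2).sub (hD 2 1)
  · exact (hD 2 0).sub (hD 0 2)
  · exact (hD 0 1).sub (hD 1 0)

/-- The action `A(t,x) u(t,x)` of a matrix field with jointly smooth entries on a jointly smooth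
vector field is jointly smooth. [folklore] -/
theorem isSmoothSpaceTimeOn_toEuclideanLin {A : ℝ → 𝕋³ → 𝕄} {u : ℝ → 𝕋³ → ℝ³}
    (hA : ∀ i j, IsSmoothSpaceTimeOn S (fun t x => A t x i j)) (hu : IsSmoothSpaceTimeOn S u) :
    IsSmoothSpaceTimeOn S (fun t x => Matrix.toEuclideanLin (A t x) (u t x)) := by
  rw [isSmoothSpaceTimeOn_iff_components]
  intro i
  have h : (fun t x => Matrix.toEuclideanLin (A t x) (u t x) i) =
      fun t x => ∑ j, A t x i j * u t x j := by
    funext t x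
    rfl
  rw [h]
  exact IsSmoothSpaceTimeOn.sum fun j _ => (hA i j).mul
    ((isSmoothSpaceTimeOn_iff_components.1 hu) j)

end Components

/-! ## Smoothness of the ingredients of the construction -/

section ConstructionSmooth

variable {P : Params} {S : Setting} {η : ℕ → ℝ → 𝕋³ → ℝ} {D : ℕ → ℝ → 𝕋³ → ℝ³}

/-- A smooth function of time is a jointly smooth (space-independent) field. [folklore] -/
theorem isSmoothSpaceTimeOn_of_time {T : ℝ} {F : Type*} [NormedAddCommGroup F] [NormedSpace ℝ F]
    {f : ℝ → F} (hf : ContDiffOn ℝ ∞ f (Icc 0 T)) :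
    IsSmoothSpaceTimeOn (Icc 0 T) (fun t (_ : 𝕋³) => f t) :=
  hf.comp contDiffOn_fst fun _ hp => (mem_prod.1 hp).1

/-- `ρ_q` is smooth on `[0,T]` (for `e` smooth on `[0,T]` and `v̄_q` jointly smooth). [folklore] -/
theorem contDiffOn_rhoQ (hT : 0 < S.T) (he : ContDiffOn ℝ ∞ S.e (Icc 0 S.T))
    (hv : IsSmoothSpaceTimeOn (Icc 0 S.T) S.vbar) : ContDiffOn ℝ ∞ (rhoQ P S) (Icc 0 S.T) := by
  have h1 : IsSmoothSpaceTimeOn (Icc 0 S.T) (fun t x => ‖S.vbar t x‖ ^ 2) := by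
    have h := hv.inner hv
    refine ContDiffOn.congr h fun z _ => ?_
    simp only [real_inner_self_eq_norm_sq]
  have h2 := contDiffOn_spaceIntegral (convex_Icc 0 S.T)
    (by rw [interior_Icc]; exact nonempty_Ioo.2 hT) h1
  unfold rhoQ
  exact ((he.sub contDiffOn_const).sub h2).div_const _

/-- `∑_j ∫ η_j²` is smooth on `[0,T]`. [folklore] -/
theorem contDiffOn_etaMass (hT : 0 < S.T) (hη : ∀ i, IsSmoothSpaceTimeOn (Icc 0 S.T) (η i)) :
    ContDiffOn ℝ ∞ (etaMass P S η) (Icc 0 S.T) := by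
  unfold etaMass
  refine ContDiffOn.sum fun j _ => ?_
  have h : IsSmoothSpaceTimeOn (Icc 0 S.T) (fun t x => η j t x ^ 2) := by
    have := (hη j).mul (hη j)
    refine ContDiffOn.congr this fun z _ => ?_
    simp only [pow_two]
  exact contDiffOn_spaceIntegral (convex_Icc 0 S.T) (by rw [interior_Icc]; exact nonempty_Ioo.2 hT) h

/-- `ρ_{q,i}` is jointly smooth on `[0,T] × T³` (where `∑∫η_j² ≠ 0`). [folklore] -/
theorem isSmoothSpaceTimeOn_rhoI (hT : 0 < S.T) (he : ContDiffOn ℝ ∞ S.e (Icc 0 S.T))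
    (hv : IsSmoothSpaceTimeOn (Icc 0 S.T) S.vbar) (hη : ∀ i, IsSmoothSpaceTimeOn (Icc 0 S.T) (η i))
    (hmass : ∀ t ∈ Icc 0 S.T, etaMass P S η t ≠ 0) (i : ℕ) :
    IsSmoothSpaceTimeOn (Icc 0 S.T) (rhoI P S η i) := by
  have h : IsSmoothSpaceTimeOn (Icc 0 S.T) (fun t x => η i t x * η i t x * (rhoQ P S t / etaMass P S η t)) :=
    ((hη i).mul (hη i)).mul
      (isSmoothSpaceTimeOn_of_time (((contDiffOn_rhoQ hT he hv).div (contDiffOn_etaMass hT hη)) hmass))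
  refine ContDiffOn.congr h fun z _ => ?_
  simp only [stLift, rhoI, pow_two]

/-- `ρ_{q,i}^{1/2}` is jointly smooth on `[0,T] × T³` (where `ρ_q / ∑∫η_j² > 0`). [folklore] -/
theorem isSmoothSpaceTimeOn_sqrtRhoI (hT : 0 < S.T) (he : ContDiffOn ℝ ∞ S.e (Icc 0 S.T))
    (hv : IsSmoothSpaceTimeOn (Icc 0 S.T) S.vbar) (hη : ∀ i, IsSmoothSpaceTimeOn (Icc 0 S.T) (η i))
    (hmass : ∀ t ∈ Icc 0 S.T, etaMass P S η t ≠ 0)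
    (hpos : ∀ t ∈ Icc 0 S.T, 0 < rhoQ P S t / etaMass P S η t) (i : ℕ) :
    IsSmoothSpaceTimeOn (Icc 0 S.T) (sqrtRhoI P S η i) :=
  (hη i).mul (isSmoothSpaceTimeOn_of_time
    ((((contDiffOn_rhoQ hT he hv).div (contDiffOn_etaMass hT hη)) hmass).sqrt
      fun t ht => (hpos t ht).ne'))

/-- The entries of `∇Φ_i = Id + ∇D_i` are jointly smooth. [folklore] -/
theorem isSmoothSpaceTimeOn_gradPhi (hT : 0 < S.T) (hD : ∀ i, IsSmoothSpaceTimeOn (Icc 0 S.T) (D i))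
    (i : ℕ) (a b : Fin 3) : IsSmoothSpaceTimeOn (Icc 0 S.T) (fun t x => gradPhi D i t x a b) := by
  have h : IsSmoothSpaceTimeOn (Icc 0 S.T)
      (fun t x => (1 : 𝕄) a b + partialDeriv b (D i t) x a) :=
    (isSmoothSpaceTimeOn_const (isSmooth_const _) _).add
      (((hD i).partialDeriv (uniqueDiffOn_Icc hT) b).apply a)
  refine ContDiffOn.congr h fun z _ => ?_
  simp only [gradPhi, Matrix.add_apply, Matrix.of_apply]

/-- The entries of the glued stress `R̊̄_q` are jointly smooth. [folklore] -/
theorem isSmoothSpaceTimeOn_Rbar_entry (hR : IsSmoothSpaceTimeOn (Icc 0 S.T) S.Rbar) (l k : Fin 3) :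
    IsSmoothSpaceTimeOn (Icc 0 S.T) (fun t x => S.Rbar t x l k) :=
  (hR.clm_comp (ContinuousLinearMap.proj (R := ℝ) (φ := fun _ : Fin 3 => ℝ³) l)).apply k

/-- The entries of `R̃_{q,i}` are jointly smooth (where `ρ_q ≠ 0`). [folklore] -/
theorem isSmoothSpaceTimeOn_tildeR (hT : 0 < S.T) (he : ContDiffOn ℝ ∞ S.e (Icc 0 S.T))
    (hv : IsSmoothSpaceTimeOn (Icc 0 S.T) S.vbar) (hR : IsSmoothSpaceTimeOn (Icc 0 S.T) S.Rbar)
    (hη : ∀ i, IsSmoothSpaceTimeOn (Icc 0 S.T) (η i)) (hD : ∀ i, IsSmoothSpaceTimeOn (Icc 0 S.T) (D i))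
    (hrho : ∀ t ∈ Icc 0 S.T, rhoQ P S t ≠ 0) (i : ℕ) (a b : Fin 3) :
    IsSmoothSpaceTimeOn (Icc 0 S.T) (fun t x => tildeR P S η D i t x a b) := by
  have hc : ContDiffOn ℝ ∞ (fun t => etaMass P S η t / rhoQ P S t) (Icc 0 S.T) :=
    (contDiffOn_etaMass hT hη).div (contDiffOn_rhoQ hT he hv) hrho
  have hM : ∀ k l : Fin 3, IsSmoothSpaceTimeOn (Icc 0 S.T)
      (fun t x => (1 - (etaMass P S η t / rhoQ P S t) • ofCols (S.Rbar t x)) k l) := by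
    intro k l
    have h : IsSmoothSpaceTimeOn (Icc 0 S.T)
        (fun t x => (1 : 𝕄) k l - etaMass P S η t / rhoQ P S t * S.Rbar t x l k) :=
      (isSmoothSpaceTimeOn_const (isSmooth_const _) _).sub
        ((isSmoothSpaceTimeOn_of_time hc).mul (isSmoothSpaceTimeOn_Rbar_entry hR l k))
    refine ContDiffOn.congr h fun z _ => ?_
    simp only [Matrix.sub_apply, Matrix.smul_apply, ofCols_apply, smul_eq_mul]
  have hG := isSmoothSpaceTimeOn_gradPhi hT hD i
  have h : IsSmoothSpaceTimeOn (Icc 0 S.T) (fun t x => ∑ l, (∑ k, gradPhi D i t x a k *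
      (1 - (etaMass P S η t / rhoQ P S t) • ofCols (S.Rbar t x)) k l) * gradPhi D i t x b l) :=
    IsSmoothSpaceTimeOn.sum fun l _ =>
      (IsSmoothSpaceTimeOn.sum fun k _ => (hG a k).mul (hM k l)).mul (hG b l)
  refine ContDiffOn.congr h fun z _ => ?_
  simp only [tildeR, Matrix.mul_apply, Matrix.transpose_apply]

/-- Composition of a Mikado profile with jointly smooth matrix and point fields is jointly smooth:
`(t, x) ↦ V(R(t,x), n • (x + D₀(t,x)))`. [folklore] -/
theorem isSmoothSpaceTimeOn_mikado_comp {T : ℝ} {V : 𝕄 → 𝕋³ → ℝ³}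
    (hV : ContDiff ℝ ∞ fun p : 𝕄 × ℝ³ => V p.1 (proj p.2)) {Rm : ℝ → 𝕋³ → 𝕄} {D₀ : ℝ → 𝕋³ → ℝ³}
    (hRm : ∀ a b, IsSmoothSpaceTimeOn (Icc 0 T) (fun t x => Rm t x a b))
    (hD₀ : IsSmoothSpaceTimeOn (Icc 0 T) D₀) (n : ℕ) :
    IsSmoothSpaceTimeOn (Icc 0 T) (fun t x => V (Rm t x) (n • (x + proj (D₀ t x)))) := by
  have hΨ : ContDiffOn ℝ ∞ (fun z : ℝ × ℝ³ => (stLift (fun t x => Rm t x) z, (n : ℝ) • (z.2 + stLift D₀ z)))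
      (Icc 0 T ×ˢ univ) := by
    refine ContDiffOn.prodMk ?_ ((contDiffOn_snd.add hD₀).const_smul (n : ℝ))
    exact contDiffOn_pi' fun a => contDiffOn_pi' fun b => hRm a b
  have h := hV.comp_contDiffOn hΨ
  refine ContDiffOn.congr h fun z _ => ?_
  obtain ⟨t, y⟩ := z
  simp only [stLift_apply, Function.comp_apply]
  rw [Nat.cast_smul_eq_nsmul, proj_nsmul, proj_add]

end ConstructionSmooth

/-! ## Smoothness of the perturbation, the new stress and the new pressure -/

section PerturbationSmooth

variable {P : Params} {S : Setting} {η : ℕ → ℝ → 𝕋³ → ℝ} {D : ℕ → ℝ → 𝕋³ → ℝ³}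

/-- The smoothness and positivity hypotheses under which the construction of §5 is smooth on
`[0,T] × T³`: `T > 0`; `e` smooth on `[0,T]`; `v̄_q, p̄_q, R̊̄_q`, the cut-offs `η_i` and the
displacements `D_i` jointly smooth; `ρ_q > 0` (Lemma 5.4 (5.15)) and `∑_j∫η_j² > 0` (property (v))
on `[0,T]`. [cite: BuckmasterEtAl2018, §5.2–5.3] -/
structure SmoothData (P : Params) (S : Setting) (η : ℕ → ℝ → 𝕋³ → ℝ) (D : ℕ → ℝ → 𝕋³ → ℝ³) :
    Prop where
  /-- `0 < T`. -/
  pos_T : 0 < S.T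
  /-- `e` is smooth on `[0,T]`. -/
  e : ContDiffOn ℝ ∞ S.e (Icc 0 S.T)
  /-- `v̄_q` is jointly smooth. -/
  vbar : IsSmoothSpaceTimeOn (Icc 0 S.T) S.vbar
  /-- `p̄_q` is jointly smooth. -/
  pbar : IsSmoothSpaceTimeOn (Icc 0 S.T) S.pbar
  /-- `R̊̄_q` is jointly smooth. -/
  Rbar : IsSmoothSpaceTimeOn (Icc 0 S.T) S.Rbar
  /-- the cut-offs are jointly smooth. -/
  eta : ∀ i, IsSmoothSpaceTimeOn (Icc 0 S.T) (η i)
  /-- the displacements are jointly smooth. -/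
  disp : ∀ i, IsSmoothSpaceTimeOn (Icc 0 S.T) (D i)
  /-- `ρ_q > 0` on `[0,T]`. -/
  rho_pos : ∀ t ∈ Icc 0 S.T, 0 < rhoQ P S t
  /-- `∑_j ∫ η_j² > 0` on `[0,T]`. -/
  mass_pos : ∀ t ∈ Icc 0 S.T, 0 < etaMass P S η t

namespace SmoothData

variable (h : SmoothData P S η D)
include h

/-- `[0,T]` has unique derivatives. [folklore] -/
theorem uniqueDiffOn : UniqueDiffOn ℝ (Icc 0 S.T) := uniqueDiffOn_Icc h.pos_T

/-- `ρ_{q,i}` is jointly smooth. [folklore] -/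
theorem rhoI (i : ℕ) : IsSmoothSpaceTimeOn (Icc 0 S.T) (BDSV.rhoI P S η i) :=
  isSmoothSpaceTimeOn_rhoI h.pos_T h.e h.vbar h.eta (fun t ht => (h.mass_pos t ht).ne') i

/-- `ρ_{q,i}^{1/2}` is jointly smooth. [folklore] -/
theorem sqrtRhoI (i : ℕ) : IsSmoothSpaceTimeOn (Icc 0 S.T) (BDSV.sqrtRhoI P S η i) :=
  isSmoothSpaceTimeOn_sqrtRhoI h.pos_T h.e h.vbar h.eta (fun t ht => (h.mass_pos t ht).ne')
    (fun t ht => div_pos (h.rho_pos t ht) (h.mass_pos t ht)) i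

/-- The Mikado factor `V(R̃_{q,i}, n_{q+1} Φ_i)` is jointly smooth. [folklore] -/
theorem mikadoV {r : ℝ} (𝔚 : MikadoDatum r) (i : ℕ) :
    IsSmoothSpaceTimeOn (Icc 0 S.T)
      (fun t x => 𝔚.V (tildeR P S η D i t x) (P.freqNat (S.q + 1) • phiPoint D i t x)) :=
  isSmoothSpaceTimeOn_mikado_comp 𝔚.smooth_V
    (isSmoothSpaceTimeOn_tildeR h.pos_T h.e h.vbar h.Rbar h.eta h.disp
      (fun t ht => (h.rho_pos t ht).ne') i) (h.disp i) _

/-- The potential `Z` of (5.28) is jointly smooth. [folklore] -/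
theorem potential (𝔚 : MikadoDatum mikadoRadius) :
    IsSmoothSpaceTimeOn (Icc 0 S.T) (BDSV.potential P S 𝔚 η D) :=
  IsSmoothSpaceTimeOn.sum fun i _ => (h.sqrtRhoI i).smul
    (isSmoothSpaceTimeOn_toEuclideanLin
      (fun a b => isSmoothSpaceTimeOn_gradPhi h.pos_T h.disp i b a) (h.mikadoV 𝔚 i))

/-- The perturbation `w_{q+1}` is jointly smooth. [folklore] -/
theorem perturbation (𝔚 : MikadoDatum mikadoRadius) :
    IsSmoothSpaceTimeOn (Icc 0 S.T) (BDSV.perturbation P S 𝔚 η D) :=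
  ((h.potential 𝔚).curl h.uniqueDiffOn).const_smul _

/-- The new velocity `v_{q+1} = v̄_q + w_{q+1}` is jointly smooth. [folklore] -/
theorem newVelocity (𝔚 : MikadoDatum mikadoRadius) :
    IsSmoothSpaceTimeOn (Icc 0 S.T) (BDSV.newVelocity P S 𝔚 η D) :=
  h.vbar.add (h.perturbation 𝔚)

/-- The columns of the stress `R̄_q = ∑_i R_{q,i}` are jointly smooth. [folklore] -/
theorem stressSum_column (j : Fin 3) :
    IsSmoothSpaceTimeOn (Icc 0 S.T) (fun t x => BDSV.stressSum P S η t x j) :=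
  IsSmoothSpaceTimeOn.sum fun i _ =>
    ((h.rhoI i).smul (isSmoothSpaceTimeOn_const (isSmooth_const _) _)).sub
      (((h.eta i).mul (h.eta i)).smul
        (h.Rbar.clm_comp (ContinuousLinearMap.proj (R := ℝ) (φ := fun _ : Fin 3 => ℝ³) j))
        |>.congr fun z _ => by simp only [stLift, pow_two, ContinuousLinearMap.proj_apply])

/-- The oscillation tensor `w ⊗ w - R̄_q` (columns `w_j w - R̄_q e_j`) is jointly smooth. [folklore] -/
theorem oscillationTensor (𝔚 : MikadoDatum mikadoRadius) :
    IsSmoothSpaceTimeOn (Icc 0 S.T) (fun t y j =>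
      BDSV.perturbation P S 𝔚 η D t y j • BDSV.perturbation P S 𝔚 η D t y -
        BDSV.stressSum P S η t y j) :=
  contDiffOn_pi' fun j => (((h.perturbation 𝔚).apply j).smul (h.perturbation 𝔚)).sub
    (h.stressSum_column j)

omit h in
/-- The divergence of a jointly smooth tensor field is jointly smooth. [folklore] -/
theorem _root_.Literature.Analysis.FunctionSpaces.Torus.IsSmoothSpaceTimeOn.tensorDivergence
    {S' : Set ℝ} {σ : ℝ → 𝕋³ → Fin 3 → ℝ³} (hσ : IsSmoothSpaceTimeOn S' σ) (hS' : UniqueDiffOn ℝ S') :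
    IsSmoothSpaceTimeOn S' (fun t => Torus.tensorDivergence (σ t)) :=
  IsSmoothSpaceTimeOn.sum fun j _ =>
    (hσ.clm_comp (ContinuousLinearMap.proj (R := ℝ) (φ := fun _ : Fin 3 => ℝ³) j)).partialDeriv hS' j

/-- The source `F = ∂ₜw + (v̄·∇)w + (w·∇)v̄ + div(w ⊗ w - R̄_q)` of (5.23) is jointly smooth. [folklore] -/
theorem stressSource (𝔚 : MikadoDatum mikadoRadius) :
    IsSmoothSpaceTimeOn (Icc 0 S.T) (BDSV.stressSource P S 𝔚 η D) :=
  ((((h.perturbation 𝔚).timeDerivWithin h.uniqueDiffOn).add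
    (h.vbar.convect (h.perturbation 𝔚) h.uniqueDiffOn)).add
    ((h.perturbation 𝔚).convect h.vbar h.uniqueDiffOn)).add
    ((h.oscillationTensor 𝔚).tensorDivergence h.uniqueDiffOn)

/-- The new stress `R̊_{q+1} = ℛ F` is jointly smooth. [folklore] -/
theorem newStress (𝔚 : MikadoDatum mikadoRadius) :
    IsSmoothSpaceTimeOn (Icc 0 S.T) (BDSV.newStress P S 𝔚 η D) :=
  (h.stressSource 𝔚).antidivergence (convex_Icc 0 S.T)
    (by rw [interior_Icc]; exact nonempty_Ioo.2 h.pos_T)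

/-- The new pressure `p_{q+1}` is jointly smooth. [folklore] -/
theorem newPressure : IsSmoothSpaceTimeOn (Icc 0 S.T) (BDSV.newPressure P S η) :=
  (h.pbar.add (isSmoothSpaceTimeOn_of_time (contDiffOn_rhoQ h.pos_T h.e h.vbar))).sub
    (IsSmoothSpaceTimeOn.sum fun i _ => h.rhoI i)

end SmoothData

end PerturbationSmooth

end BDSV

end Literature.Analysis.FluidPDE
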